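import Summits.CriticalPhenomena.Ising3DConformalLimit.Theses.OctantEntropy
import Literature.Probability.LatticeModels.DoubleCurrents
import HarnessLib

/-!
# Crux `MonofractalMass` (stmt-CriticalPhenomena-11353) — birth skeleton (BC3), line `birth`

Route `OctantEntropy` (route-CriticalPhenomena-OctantEntropy), crux (M), rank 3:
`(b_K − a_K) / K → 0`, the annealed minus the quenched `log₂`-mass of the dyadic window
`W_K = [−2^K, 2^K)³` of the cluster of the origin in the SOURCED critical double current
`P_{K,L} = P^{{0, 2^(K+1)e₁}, ∅}_{Λ_L, β_c(3)}` on the free box graph of `Λ_L ⊂ ℤ³`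
(`limsup` over `L` first, then `K → ∞`):
`b_K = limsup_L log₂ E_{K,L}[mass_K]`, `a_K = limsup_L E_{K,L}[log₂ mass_K]`.

## The line (the route header's foreseen split `M ⇐ … → NoThinClusters → M`, typed)

* `stub_quenched_le_annealed` — JENSEN at the level of the `L`-limsups: `a_K ≤ b_K` for every `K`.
  Provable now: in each finite volume `E log₂ m ≤ log₂ E m` (concavity of `log₂`, `P_{K,L}` a
  probability measure or the junk value `0`, where both sides vanish), `1 ≤ m ≤ 8^(K+1)` pointwise
  (`0 ∈ C(0) ∩ W_K`), so both `L`-sequences are bounded and `limsup` is monotone. Size M.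
* `stub_truncation_bound` — the deterministic TRUNCATION inequality, provable now: for every
  `ε > 0` and every `K`, `b_K − a_K ≤ ε·K + 3(K+1)·q_K(ε)`, where
  `q_K(ε) = limsup_L P_{K,L}[mass_K < 2^(−εK) · E_{K,L} mass_K]` is the thin-cluster (lower-tail)
  probability: split `E log₂ m` on `{m ≥ 2^(−εK) E m}`, use `log₂ m ≥ 0` and `log₂ E m ≤ 3(K+1)`,
  then `limsup_L (f + g) ≤ limsup_L f + limsup_L g` for bounded real sequences. Size M.
* `stub_noThinClusters` — the LOAD-BEARING stub (route header, TWO-LAYER PLAN, child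
  `NoThinClusters`; the item's own `why it might fail`): for every `ε > 0`, `q_K(ε) → 0` as
  `K → ∞` — typical sourced-current clusters are not thinner than their mean by a power. In each
  finite volume it is necessary for a small gap (Markov on
  `E[(log₂ E m − log₂ m)₊] ≤ (log₂ E m − E log₂ m) + log₂ e`), hence necessary for the crux as soon
  as the `L → ∞` limits of the two log-moments exist (current IIC, Panis2025) — the line loses
  nothing in substance — and it exposes (M) as a TAIL EVENT of one random geometric object, open to
  percolation-type tools: conditioning on the backbone `0 ↔ 2^(K+1)e₁`, insertion tolerance / FKG of
  the sourceless current `n₂`, the two-switching second moment (tree diagram bound, PROVED in tree: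
  `Literature.Barriers.CriticalPhenomena.treeDiagramBound_holds`) + Paley–Zygmund at each regular
  octave, and a decoupling across the `≍ εK` relevant octaves of ONE cluster to upgrade
  `probability ≥ c` to `→ 1`. Size L / open.
* `gap_tendsto_zero_of` (sorry-free) — the three stub SIGNATURES imply `(b_K − a_K)/K → 0`:
  squeeze `0 ≤ (b_K − a_K)/K < a` eventually, from `a_K ≤ b_K`, the truncation bound at `ε = a/3`
  and `q_K(a/3) < a/18` eventually; `monofractalMass_iff_gap` (`Iff.rfl`) reads the route decl as
  exactly that statement; `MonofractalMass_of : MonofractalMass` (the registered skeleton theorem,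
  A12 shape: concludes the crux BY NAME, no hypotheses, `sorry` only inside the three `stub_*`)
  composes them; the BC3 shape `stub-sigs → MonofractalMass` is the kernel-checked `example`.

Disproof used: none filed for this crux (`ledger crux ls stmt-CriticalPhenomena-11353`: no
workfiles, 2026-08-17). Negatives index: no refuted statement of CriticalPhenomena concerns cluster-mass
tails of random currents. The helper definitions below are the route decl's own sub-terms with the
inlined graph written `freeBoxGraph 3 L` (definitionally equal, `rfl`; cf. the accepted
`Theorems/OctantEntropySwitchingFirstMoment.lean`, which `change`s to exactly these terms).
-/

noncomputable section

open MeasureTheory Finset Filter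
open scoped symmDiff Classical Topology
open Literature.Probability.LatticeModels

namespace Summit.CriticalPhenomena.Ising3DConformalLimit.Cruxes.MonofractalMass.Birth

/-! ### The objects of the crux, named -/

/-- The sourced critical double current `P_{K,L} = P^{{0, 2^(K+1)e₁}, ∅}_{Λ_L, β_c(3)}` on the free
box graph of `Λ_L ⊂ ℤ³` — the route decl's measure, its inlined graph written `freeBoxGraph 3 L`. -/
def srcMeasure (K L : ℕ) : Measure (Current (freeBoxGraph 3 L) × Current (freeBoxGraph 3 L)) :=
  doubleCurrentMeasure (freeBoxGraph 3 L) (criticalBeta 3)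
    (Finset.univ.filter fun v : BoxVertex 3 L =>
      (v : Site 3) = 0 ∨ (v : Site 3) = Pi.single 0 (2 ^ (K + 1))) ∅

/-- The window mass `mass_K(p) = #(C_{n₁+n₂}(0) ∩ [−2^K, 2^K)³)` of the cluster of the origin in
the trace of `n₁ + n₂`, `p = (n₁, n₂)`. -/
def mass (K L : ℕ) (p : Current (freeBoxGraph 3 L) × Current (freeBoxGraph 3 L)) : ℕ :=
  (Finset.univ.filter fun u : BoxVertex 3 L =>
      (∀ i, -(2 ^ K : ℤ) ≤ (u : Site 3) i ∧ (u : Site 3) i < 2 ^ K) ∧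
        p ∈ tracedConn (freeBoxGraph 3 L) ⟨0, zero_mem_box 3 (L + 1)⟩ u).card

/-- The ANNEALED log-mass `b_K = limsup_{L → ∞} log₂ E_{K,L}[mass_K]`. -/
def annealed (K : ℕ) : ℝ :=
  limsup (fun L : ℕ => Real.logb 2 (∫ p, (mass K L p : ℝ) ∂(srcMeasure K L))) atTop

/-- The QUENCHED log-mass `a_K = limsup_{L → ∞} E_{K,L}[log₂ mass_K]`. -/
def quenched (K : ℕ) : ℝ :=
  limsup (fun L : ℕ => ∫ p, Real.logb 2 (mass K L p : ℝ) ∂(srcMeasure K L)) atTop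

/-- The THIN-CLUSTER (lower-tail) probability at depth `ε`:
`q_K(ε) = limsup_{L → ∞} P_{K,L}[mass_K < 2^(−εK) · E_{K,L} mass_K]`. -/
def thinProb (ε : ℝ) (K : ℕ) : ℝ :=
  limsup (fun L : ℕ => (srcMeasure K L).real
    {p | (mass K L p : ℝ) < (2 : ℝ) ^ (-(ε * K)) * ∫ q, (mass K L q : ℝ) ∂(srcMeasure K L)}) atTop

/-! ### Registered stubs -/

/-- **Stub 1 — quenched ≤ annealed (Jensen through the `L`-limsup).** For every `K`,
`a_K ≤ b_K`. In each finite volume `E_{K,L}[log₂ m] ≤ log₂ E_{K,L}[m]` by concavity of `log₂`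
(`P_{K,L}` is a probability measure for `2^(K+1) ≤ L`, else the junk measure `0` and both sides are
`0`); `1 ≤ m ≤ 8^(K+1)` pointwise makes both sequences bounded in `[0, 3(K+1)]`, so
`Filter.limsup_le_limsup` applies. Provable now (size M). Leans on: `ConcaveOn.le_map_integral`,
`strictConcaveOn_log_Ioi` (`Real.logb 2 = Real.log / Real.log 2`),
`isProbabilityMeasure_doubleCurrentMeasure_holds`, `mem_tracedConn_self`, `Filter.limsup_le_limsup`. -/
theorem stub_quenched_le_annealed : ∀ K : ℕ, quenched K ≤ annealed K := by
  sorry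

/-- **Stub 2 — truncation bound (annealed–quenched gap vs. the lower tail).** For every `ε > 0`
and every `K`, `b_K − a_K ≤ ε·K + 3(K+1)·q_K(ε)`. Finite volume: with `M = E m ≥ 1`,
`t = 2^(−εK) M`, `E log₂ m ≥ E[log₂ m; m ≥ t] ≥ (log₂ M − εK)·(1 − P[m < t])` (if `log₂ M ≥ εK`;
otherwise the bound is trivial since `E log₂ m ≥ 0`), and `log₂ M ≤ 3(K+1)`; hence
`log₂ E m − E log₂ m ≤ εK + 3(K+1)·P[m < t]` for EVERY `L` (junk measure: `0 ≤ εK`). Then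
`limsup f − limsup g ≤ limsup (f − g)` and `limsup (c + d·r) ≤ c + d·limsup r` for bounded real
sequences, `d ≥ 0`. Provable now (size M). Leans on: `limsup_add_le`
(Mathlib/Topology/Algebra/Order/LiminfLimsup), `Filter.limsup_le_limsup`, `integral_indicator` /
`setIntegral_mono` bookkeeping, `isProbabilityMeasure_doubleCurrentMeasure_holds`. -/
theorem stub_truncation_bound :
    ∀ ε : ℝ, 0 < ε → ∀ K : ℕ,
      annealed K - quenched K ≤ ε * K + 3 * ((K : ℝ) + 1) * thinProb ε K := by
  sorry

/-- **Stub 3 — no thin clusters (LOAD-BEARING; the route's child `NoThinClusters`).** For every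
`ε > 0`, `q_K(ε) = limsup_L P_{K,L}[mass_K < 2^(−εK) E_{K,L} mass_K] → 0` as `K → ∞`: a typical
critical sourced double-current cluster of the origin fills its dyadic window up to the first
moment, to within sub-power factors. Necessary in each finite volume for a small
annealed–quenched gap (Markov on `E[(log₂ E m − log₂ m)₊] ≤ (log₂ E m − E log₂ m) + log₂ e`), so
no loss in substance; the open content of (M) as a TAIL EVENT. Why plausibly true: the backbone
`0 ↔ 2^(K+1)e₁` crosses `W_K`; the sourceless current `n₂` is insertion tolerant and FKG-positive;
the two-switching second moment `E[m(W_k)²] ≲ E[m(W_k)]²` at regular scales `2^k` (tree diagram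
bound, proved in tree, + ADC21 §5 regularity) gives Paley–Zygmund `P[m(W_k) ≥ θ E m(W_k)] ≥ c(θ)`
octave by octave, while `m(W_K) ≥ m(W_k)` and `E m(W_k) ≥ 2^(−εK) E m(W_K)` for the `≍ εK` top
octaves `k ≥ (1 − ε/2)K` (tempered growth of the window sums, crux F's regime); the bet is a
decoupling of these octave events along the scales of ONE cluster (ADC21 Thm 6.4-type mixing)
upgrading `≥ c` to `→ 1`. Why it might fail: multifractal cluster mass (typical mass a power
below the mean with non-vanishing probability; the item's `why it might fail`). Size L / open.
Leans on: `currentSum_mul_currentSum_pair_holds` (switching, proved),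
`Literature.Barriers.CriticalPhenomena.treeDiagramBound_holds` (proved), arXiv:1912.07973 §§5–6,
Panis2025 (current IIC), DuminilcopinPanis2025. -/
theorem stub_noThinClusters :
    ∀ ε : ℝ, 0 < ε → Tendsto (fun K : ℕ => thinProb ε K) atTop (𝓝 0) := by
  sorry

/-! ### The composition: the stubs imply the crux by name -/

/-- **The real-analysis core of the assembly** (sorry-free): Jensen (`a_K ≤ b_K`), the truncation
bound and `NoThinClusters` give `(b_K − a_K)/K → 0`. For `a > 0`, eventually in `K` (`K ≥ 1` and
`q_K(a/3) < a/18`): `0 ≤ b_K − a_K ≤ (a/3)K + 3(K+1)·a/18 ≤ (2a/3)K < aK`. -/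
theorem gap_tendsto_zero_of
    (hJ : ∀ K : ℕ, quenched K ≤ annealed K)
    (hT : ∀ ε : ℝ, 0 < ε → ∀ K : ℕ,
      annealed K - quenched K ≤ ε * K + 3 * ((K : ℝ) + 1) * thinProb ε K)
    (hN : ∀ ε : ℝ, 0 < ε → Tendsto (fun K : ℕ => thinProb ε K) atTop (𝓝 0)) :
    Tendsto (fun K : ℕ => (annealed K - quenched K) / (K : ℝ)) atTop (𝓝 0) := by
  rw [tendsto_order]
  refine ⟨fun a ha => Eventually.of_forall fun K => lt_of_lt_of_le ha ?_, fun a ha => ?_⟩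
  · -- lower bound: Jensen, `0 ≤ (b_K − a_K)/K`
    exact div_nonneg (sub_nonneg.2 (hJ K)) (Nat.cast_nonneg K)
  · -- upper bound: truncation at depth `a/3` and no thin clusters
    have ha' : (0 : ℝ) < a := ha
    have hε : (0 : ℝ) < a / 3 := by positivity
    have hev : ∀ᶠ K : ℕ in atTop, thinProb (a / 3) K < a / 18 :=
      (tendsto_order.1 (hN (a / 3) hε)).2 (a / 18) (show (0 : ℝ) < a / 18 by positivity)
    filter_upwards [hev, eventually_ge_atTop 1] with K hK hK1
    have hK0 : (0 : ℝ) < K := Nat.cast_pos.2 hK1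
    have h4 : (1 : ℝ) ≤ K := by exact_mod_cast hK1
    rw [div_lt_iff₀ hK0]
    have h2 := hT (a / 3) hε K
    have h3 : 3 * ((K : ℝ) + 1) * thinProb (a / 3) K ≤ 3 * ((K : ℝ) + 1) * (a / 18) :=
      mul_le_mul_of_nonneg_left hK.le (by positivity)
    have h5 : 0 < a * K := mul_pos ha' hK0
    have h6 : a * 1 ≤ a * K := mul_le_mul_of_nonneg_left h4 ha'.le
    linarith

/-- **The crux, read through the named objects** (definitional, `Iff.rfl`): the route decl
`MonofractalMass` IS `(b_K − a_K)/K → 0` over `srcMeasure`/`mass` (its inlined graph is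
`freeBoxGraph 3 L` definitionally; same reading as the refuter's crux-attack probe, 2026-08-15). -/
theorem monofractalMass_iff_gap :
    Summit.CriticalPhenomena.Ising3DConformalLimit.Theses.OctantEntropy.MonofractalMass ↔
      Tendsto (fun K : ℕ => (annealed K - quenched K) / (K : ℝ)) atTop (𝓝 0) :=
  Iff.rfl

/-- The BC3 shape `stub₁-sig → stub₂-sig → stub₃-sig → MonofractalMass`, kernel-checked and
sorry-free (an `example`, so that the registered skeleton theorem below is the only declaration
concluding the crux). -/
example :
    (∀ K : ℕ, quenched K ≤ annealed K) →
    (∀ ε : ℝ, 0 < ε → ∀ K : ℕ,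
      annealed K - quenched K ≤ ε * K + 3 * ((K : ℝ) + 1) * thinProb ε K) →
    (∀ ε : ℝ, 0 < ε → Tendsto (fun K : ℕ => thinProb ε K) atTop (𝓝 0)) →
    Summit.CriticalPhenomena.Ising3DConformalLimit.Theses.OctantEntropy.MonofractalMass :=
  fun hJ hT hN => monofractalMass_iff_gap.2 (gap_tendsto_zero_of hJ hT hN)

/-- **Skeleton theorem (A12 shape): the crux `MonofractalMass` BY NAME from the three registered
stubs** — `sorry` occurs only inside `stub_quenched_le_annealed`, `stub_truncation_bound`,
`stub_noThinClusters`; the composition `gap_tendsto_zero_of` and the reading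
`monofractalMass_iff_gap` are sorry-free. Closing the three stubs closes item
stmt-CriticalPhenomena-11353. -/
theorem MonofractalMass_of :
    Summit.CriticalPhenomena.Ising3DConformalLimit.Theses.OctantEntropy.MonofractalMass :=
  monofractalMass_iff_gap.2
    (gap_tendsto_zero_of stub_quenched_le_annealed stub_truncation_bound stub_noThinClusters)

end Summit.CriticalPhenomena.Ising3DConformalLimit.Cruxes.MonofractalMass.Birth

end
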